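import Mathlib
import HarnessLib
import HarnessLib.Audit
import Summits.ValiantsHypothesis.ValiantsHypothesis.Theorems.LacunarySymmetroidMatrixDescartesConcavity

/-!
# ValiantsHypothesis / LacunarySymmetroid — crux `MatrixDescartes` (stmt-ValiantsHypothesis-18050, V1), LINE (A) «product_plus_one»:
# the LOCAL EXPONENT SANDWICH and the RICCATI inequalities of a row's logarithmic derivative

Ninth part of the concavity budget.  For a row `g = a₀ + a₁t^a + a₂t^c` write `N = t·g′ = a·a₁t^a + c·a₂t^c` (`mul_eval_derivative_row`) and
`θN = t·N′ = t²g″ + tg′ = a²·a₁t^a + c²·a₂t^c`.  For rows with `a₁, a₂ ≤ 0` (the `(+,−,−)` class, degenerate letters allowed; `N ≤ 0`):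

* `theta_mul_eval_derivative_row` — `t·(d/dt)(t g′) = a²a₁t^a + c²a₂t^c` as a `HasDerivAt` statement for `x ↦ x·g′(x)`;
* ★ `localExponent_sandwich` — `c·N(t) ≤ θN(t) ≤ a·N(t)` (`0 < a ≤ c`, `t > 0`): the row's local exponent `θN/N` lies in `[a, c]`;
* ★ `hasDerivAt_logDeriv_row` — off the roots, `u(x) = x g′(x)/g(x)` has `t·u′(t) = θN(t)/g(t) − u(t)²`;
* ★ `riccati_unswitched` / `riccati_switched` — with `b = −u ≥ 0` on the side `g(t) > 0` («unswitched», root to the right):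
  `a·b + b² ≤ t·b′ ≤ c·b + b²`; on the side `g(t) < 0` («switched», `u ≥ 0`): `a·u − u² ≤ t·u′ ≤ c·u − u²`.
  Summed over a company these are the growth laws `θB ≥ aB + B²/#U` of the unswitched pull and `θA ≥ aA − Σ_S u_j²` of the switched pull
  behind the dip mechanism (NOTE rev 3 of this hand); here only the per-row kernel statements are landed.

HONEST FRAMING: per-row calculus, def-free, no named facts, no sorry, standard axioms; closes NO stub by name; `OneChangeFloorK3`,
`MatrixDescartes` (stmt-ValiantsHypothesis-18050) OPEN; `VP ≠ VNP` is NOT proved and nothing here bears on it.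

[folklore] Elementary calculus; no citation needed.
-/

set_option linter.dupNamespace false

namespace Summit.ValiantsHypothesis.ValiantsHypothesis.Theorems.LacunarySymmetroidMatrixDescartes

namespace ZeroChange

open Polynomial

/-- `x ↦ x·g′(x)` is the evaluation of the polynomial `X·g′`, and `t·(X·g′)′(t) = t²g″(t) + t g′(t) = a²a₁t^a + c²a₂t^c`. -/
theorem theta_mul_eval_derivative_row (a c : ℕ) (a₀ a₁ a₂ t : ℝ) :
    t * (derivative (X * derivative (row a c a₀ a₁ a₂))).eval t = (a : ℝ) ^ 2 * a₁ * t ^ a + (c : ℝ) ^ 2 * a₂ * t ^ c := by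
  have h1 := mul_eval_derivative_row a c a₀ a₁ a₂ t
  have h2 := sq_mul_eval_derivative2_row a c a₀ a₁ a₂ t
  rw [derivative_mul, derivative_X, one_mul, eval_add, eval_mul, eval_X, mul_add, ← mul_assoc, ← sq, h2]
  linarith [h1]

/-- ★ **Local exponent sandwich**: for a row with `a₁, a₂ ≤ 0`, `0 < a ≤ c`, `t > 0`: `c·N ≤ θN ≤ a·N` where `N = t g′(t) ≤ 0` and
`θN = a²a₁t^a + c²a₂t^c` (the local exponent `θN/N ∈ [a, c]`). -/
theorem localExponent_sandwich (a c : ℕ) (hac : a ≤ c) (a₀ a₁ a₂ : ℝ) (h₁ : a₁ ≤ 0) (h₂ : a₂ ≤ 0) {t : ℝ} (ht : 0 < t) :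
    (c : ℝ) * (t * (derivative (row a c a₀ a₁ a₂)).eval t) ≤ (a : ℝ) ^ 2 * a₁ * t ^ a + (c : ℝ) ^ 2 * a₂ * t ^ c ∧
    (a : ℝ) ^ 2 * a₁ * t ^ a + (c : ℝ) ^ 2 * a₂ * t ^ c ≤ (a : ℝ) * (t * (derivative (row a c a₀ a₁ a₂)).eval t) := by
  rw [mul_eval_derivative_row]
  have ha : (0 : ℝ) ≤ a := Nat.cast_nonneg a
  have hca : (0 : ℝ) ≤ (c : ℝ) - a := by
    have : (a : ℝ) ≤ c := by exact_mod_cast hac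
    linarith
  have hta : a₁ * t ^ a ≤ 0 := mul_nonpos_iff.2 (Or.inr ⟨h₁, (pow_pos ht a).le⟩)
  have htc : a₂ * t ^ c ≤ 0 := mul_nonpos_iff.2 (Or.inr ⟨h₂, (pow_pos ht c).le⟩)
  have hc : (0 : ℝ) ≤ c := Nat.cast_nonneg c
  constructor
  · -- `θN − cN = a(a−c)·a₁t^a ≥ 0`
    nlinarith [mul_nonneg (mul_nonneg ha hca) (neg_nonneg.2 hta)]
  · -- `aN − θN = c(a−c)·a₂t^c ≥ 0`
    nlinarith [mul_nonneg (mul_nonneg hc hca) (neg_nonneg.2 htc)]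

/-- ★ **Derivative of the logarithmic derivative** `u(x) = x g′(x)/g(x)` of a row off its roots:
`t·u′(t) = θN(t)/g(t) − u(t)²` with `θN = a²a₁t^a + c²a₂t^c`. -/
theorem hasDerivAt_logDeriv_row (a c : ℕ) (a₀ a₁ a₂ : ℝ) {t : ℝ} (hg : (row a c a₀ a₁ a₂).eval t ≠ 0) :
    ∃ u' : ℝ, HasDerivAt (fun x => x * (derivative (row a c a₀ a₁ a₂)).eval x / (row a c a₀ a₁ a₂).eval x) u' t ∧
      t * u' = ((a : ℝ) ^ 2 * a₁ * t ^ a + (c : ℝ) ^ 2 * a₂ * t ^ c) / (row a c a₀ a₁ a₂).eval t -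
        (t * (derivative (row a c a₀ a₁ a₂)).eval t / (row a c a₀ a₁ a₂).eval t) ^ 2 := by
  set g := row a c a₀ a₁ a₂ with hgdef
  set p : ℝ[X] := X * derivative g with hp
  have hpev : ∀ x, p.eval x = x * (derivative g).eval x := by
    intro x; simp [hp]
  have hnum : HasDerivAt (fun x => p.eval x) ((derivative p).eval t) t := p.hasDerivAt t
  have hden : HasDerivAt (fun x => g.eval x) ((derivative g).eval t) t := g.hasDerivAt t
  have hquot := hnum.div hden hg
  refine ⟨((derivative p).eval t * g.eval t - p.eval t * (derivative g).eval t) / (g.eval t) ^ 2, ?_, ?_⟩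
  · have e : (fun x => x * (derivative g).eval x / g.eval x) = fun x => p.eval x / g.eval x := by
      funext x; rw [hpev]
    rw [e]
    exact hquot
  · have hθ : t * (derivative p).eval t = (a : ℝ) ^ 2 * a₁ * t ^ a + (c : ℝ) ^ 2 * a₂ * t ^ c := by
      rw [hp, hgdef]; exact theta_mul_eval_derivative_row a c a₀ a₁ a₂ t
    rw [hpev t, ← hθ]
    field_simp

/-- ★ **Riccati inequalities, unswitched side** (`g(t) > 0`, row with `a₁, a₂ ≤ 0`, `0 < a ≤ c`, `t > 0`): the pull `b = −t g′/g ≥ 0`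
satisfies `a·b + b² ≤ t·b′ ≤ c·b + b²` — it grows at least like `e^{as}` in `s = log t` and super-linearly in itself. -/
theorem riccati_unswitched (a c : ℕ) (hac : a ≤ c) (a₀ a₁ a₂ : ℝ) (h₁ : a₁ ≤ 0) (h₂ : a₂ ≤ 0) {t : ℝ} (ht : 0 < t)
    (hg : 0 < (row a c a₀ a₁ a₂).eval t) :
    ∃ b' : ℝ, HasDerivAt (fun x => -(x * (derivative (row a c a₀ a₁ a₂)).eval x / (row a c a₀ a₁ a₂).eval x)) b' t ∧
      (a : ℝ) * (-(t * (derivative (row a c a₀ a₁ a₂)).eval t / (row a c a₀ a₁ a₂).eval t)) +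
          (t * (derivative (row a c a₀ a₁ a₂)).eval t / (row a c a₀ a₁ a₂).eval t) ^ 2 ≤ t * b' ∧
      t * b' ≤ (c : ℝ) * (-(t * (derivative (row a c a₀ a₁ a₂)).eval t / (row a c a₀ a₁ a₂).eval t)) +
          (t * (derivative (row a c a₀ a₁ a₂)).eval t / (row a c a₀ a₁ a₂).eval t) ^ 2 := by
  obtain ⟨u', hu', htu'⟩ := hasDerivAt_logDeriv_row a c a₀ a₁ a₂ hg.ne'
  obtain ⟨hlo, hhi⟩ := localExponent_sandwich a c hac a₀ a₁ a₂ h₁ h₂ ht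
  refine ⟨-u', hu'.neg, ?_, ?_⟩
  · -- `t·(−u′) = −θN/g + u² ≥ −a·(N/g) + u²` since `θN ≤ aN` and `g > 0`
    have h : ((a : ℝ) ^ 2 * a₁ * t ^ a + (c : ℝ) ^ 2 * a₂ * t ^ c) / (row a c a₀ a₁ a₂).eval t ≤
        (a : ℝ) * (t * (derivative (row a c a₀ a₁ a₂)).eval t / (row a c a₀ a₁ a₂).eval t) := by
      rw [← mul_div_assoc]
      exact div_le_div_of_nonneg_right hhi hg.le
    rw [show t * -u' = -(t * u') from mul_neg t u', htu']
    linarith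
  · have h : (c : ℝ) * (t * (derivative (row a c a₀ a₁ a₂)).eval t / (row a c a₀ a₁ a₂).eval t) ≤
        ((a : ℝ) ^ 2 * a₁ * t ^ a + (c : ℝ) ^ 2 * a₂ * t ^ c) / (row a c a₀ a₁ a₂).eval t := by
      rw [← mul_div_assoc]
      exact div_le_div_of_nonneg_right hlo hg.le
    rw [show t * -u' = -(t * u') from mul_neg t u', htu']
    linarith

/-- ★ **Riccati inequalities, switched side** (`g(t) < 0`, row with `a₁, a₂ ≤ 0`, `0 < a ≤ c`, `t > 0`): the push `u = t g′/g ≥ 0`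
satisfies `a·u − u² ≤ t·u′ ≤ c·u − u²`. -/
theorem riccati_switched (a c : ℕ) (hac : a ≤ c) (a₀ a₁ a₂ : ℝ) (h₁ : a₁ ≤ 0) (h₂ : a₂ ≤ 0) {t : ℝ} (ht : 0 < t)
    (hg : (row a c a₀ a₁ a₂).eval t < 0) :
    ∃ u' : ℝ, HasDerivAt (fun x => x * (derivative (row a c a₀ a₁ a₂)).eval x / (row a c a₀ a₁ a₂).eval x) u' t ∧
      (a : ℝ) * (t * (derivative (row a c a₀ a₁ a₂)).eval t / (row a c a₀ a₁ a₂).eval t) -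
          (t * (derivative (row a c a₀ a₁ a₂)).eval t / (row a c a₀ a₁ a₂).eval t) ^ 2 ≤ t * u' ∧
      t * u' ≤ (c : ℝ) * (t * (derivative (row a c a₀ a₁ a₂)).eval t / (row a c a₀ a₁ a₂).eval t) -
          (t * (derivative (row a c a₀ a₁ a₂)).eval t / (row a c a₀ a₁ a₂).eval t) ^ 2 := by
  obtain ⟨u', hu', htu'⟩ := hasDerivAt_logDeriv_row a c a₀ a₁ a₂ hg.ne
  obtain ⟨hlo, hhi⟩ := localExponent_sandwich a c hac a₀ a₁ a₂ h₁ h₂ ht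
  refine ⟨u', hu', ?_, ?_⟩
  · -- dividing `θN ≤ aN` by `g < 0` flips: `a·(N/g) ≤ θN/g`
    have h : (a : ℝ) * (t * (derivative (row a c a₀ a₁ a₂)).eval t / (row a c a₀ a₁ a₂).eval t) ≤
        ((a : ℝ) ^ 2 * a₁ * t ^ a + (c : ℝ) ^ 2 * a₂ * t ^ c) / (row a c a₀ a₁ a₂).eval t := by
      rw [← mul_div_assoc]
      exact div_le_div_of_nonpos_of_le hg.le hhi
    rw [htu']
    linarith
  · have h : ((a : ℝ) ^ 2 * a₁ * t ^ a + (c : ℝ) ^ 2 * a₂ * t ^ c) / (row a c a₀ a₁ a₂).eval t ≤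
        (c : ℝ) * (t * (derivative (row a c a₀ a₁ a₂)).eval t / (row a c a₀ a₁ a₂).eval t) := by
      rw [← mul_div_assoc]
      exact div_le_div_of_nonpos_of_le hg.le hlo
    rw [htu']
    linarith

end ZeroChange

end Summit.ValiantsHypothesis.ValiantsHypothesis.Theorems.LacunarySymmetroidMatrixDescartes
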